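import Mathlib
import Summits.NavierStokesRegularity.NavierStokesRegularity.Theorems.OrthantWakeTwinSideBranch
import Summits.NavierStokesRegularity.NavierStokesRegularity.Theorems.OrthantWakeTwinEmbedding
import Summits.NavierStokesRegularity.NavierStokesRegularity.Theorems.SubOnsagerCeilingDefs
import HarnessLib

/-!
# `SubOnsagerCeiling.ForwardTailCeiling` (item 26608) implies the REFUTED-AS-TYPED ceiling of item
# 25507 on its own witness table `α_SB`
(helper file for item stmt-NavierStokesRegularity-26608 `SubOnsagerCeiling.ForwardTailCeiling`;
`--supports`; prover ns-ow-p1 g4, twin-embedding argument)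

`forwardTailCeiling_imp_ceilingAt_sideBranchTable : ForwardTailCeiling → ∀ ε₀ ∈ (0,1],
CeilingAt 10 ε₀ sideBranchTable`. The rev-2 repair of route SubOnsagerCeiling replaced the total
tail ceiling `OrthantTailCeiling` (item 25507, refuted in numerics on the dead-end table `α_SB`:
`Cruxes/OrthantTailCeiling/REFUTATION-EVIDENCE.md`, parked tail energy `≍ E₀(1+ε₀)^{-Θn}`,
`Θ → 5/9 < 1` on a `ν`-growing band) by the FORWARD-SOURCE ceiling `∃ S ⊇ S⁺(α), Σ_{i∈S} …` with
the SYNTACTIC source set `S⁺(α) = {i : ∃ j l, α i j l (0,0,1) ≠ 0}`. This file proves in the kernel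
that the repair implies the old statement ON THE VERY WITNESS TABLE: apply the forward-source
ceiling to the all-source orthant table `twin-α_SB ∈ E₂(17)` (`S = univ` forced,
`Theorems/OrthantWakeTwinSideBranch.lean`) along the embedded solutions `twinEmbed X`
(`Theorems/OrthantWakeTwinEmbedding.lean`), whose shell energies are those of `X` up to the inert
component `3` on shell `0` (absorbed by `C ↦ C + 1`). Hence every numerical row against 25507 on
`α_SB` is, verbatim, a row against 26608 AS TYPED; a repair must change the CLASS (e.g. diagonal
feed forms `a ≠ b → α a b i (0,0,1) = 0`, i.e. Katz–Pavlović networks proper), not the observable.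

HONEST FRAMING: an implication between two OPEN statements about a Tao-type MODEL lattice (rung
TL-M2Break); neither is proved or refuted in the kernel; nothing bears on Navier–Stokes regularity.
-/

noncomputable section

-- the sub-problem namespace `NavierStokesRegularity.NavierStokesRegularity` is the tree's layout (D-0017)
set_option linter.dupNamespace false

namespace Summit.NavierStokesRegularity.NavierStokesRegularity.Theorems

open Literature.Analysis.FluidPDE.TaoCascade

/-! ## Reduction 1: `ForwardTailCeiling` (rev-2 repair, item 26608) implies the REFUTED-AS-TYPED
ceiling of item 25507 on the very witness table `α_SB` -/

/-- **The forward-source ceiling implies the total ceiling on `α_SB`.** If `ForwardTailCeiling`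
(route SubOnsagerCeiling, item 26608) holds then, for every scale ratio `ε₀ ∈ (0,1]`, the side-branch
dead-end table `α_SB ∈ E₂(10)` obeys `CeilingAt 10 ε₀ sideBranchTable` — the per-table body of the
aside crux `OrthantTailCeiling` (item 25507) that the lead's numerics refute on exactly this table
(`Cruxes/OrthantTailCeiling/REFUTATION-EVIDENCE.md`: `Θ → 5/9 < 1`). Proof: apply the forward-source
ceiling to the all-source table `twin-α_SB ∈ E₂(17)` (so `S = univ`) along the embedded solutions
`twinEmbed X`; their shell energies are those of `X` except the inert component `3` on shell `0`,
absorbed by `C ↦ C + 1`. MODEL lattice only; an implication between two open statements; nothing is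
asserted about either. [this file] -/
theorem forwardTailCeiling_imp_ceilingAt_sideBranchTable
    (h : Summit.NavierStokesRegularity.NavierStokesRegularity.Theses.SubOnsagerCeiling.ForwardTailCeiling)
    {ε₀ : ℝ} (hε : 0 < ε₀) (hε1 : ε₀ ≤ 1) :
    SubOnsagerCeiling.CeilingAt 10 ε₀ SubOnsagerCeiling.sideBranchTable := by
  intro _hclass _horth
  obtain ⟨S, hS, θ, hθ, C, hC, hceil⟩ := h 17 (by norm_num) ε₀ hε hε1 twinSideBranchTable
    twinSideBranchTable_inTableClass twinSideBranchTable_orthant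
  have hSu : S = Finset.univ := twinSideBranchTable_allSource S hS
  subst hSu
  refine ⟨θ, hθ, C + 1, by linarith, ?_⟩
  intro ν hν X₀ s hs X hinit hlow hbd hcont hder hpos n N hnN t ht
  obtain ⟨M, hM⟩ := hbd
  have key := hceil ν hν (twinMix X₀) s hs (twinEmbed X) (twinEmbed_init hinit) (twinEmbed_low hlow)
    ⟨M, twinEmbed_bound hε hM⟩ (twinEmbed_continuous hcont) (twinEmbed_hasDerivWithinAt hder)
    (twinEmbed_nonneg hpos) n N hnN t ht
  -- energies of the embedding
  have hE0 : (∑ i : Fin 4, (1 / 2 : ℝ) * twinMix X₀ i ^ 2) ≤ ∑ i : Fin 4, (1 / 2 : ℝ) * X₀ i ^ 2 := by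
    rw [sum_sq_twinMix]; nlinarith [sq_nonneg (X₀ 3)]
  have hsplit : ∑ k ∈ Finset.Icc n N, ∑ i : Fin 4, (1 / 2 : ℝ) * X i (k : ℤ) t ^ 2 =
      (∑ k ∈ Finset.Icc n N, ∑ i : Fin 4, (1 / 2 : ℝ) * twinEmbed X i (k : ℤ) t ^ 2) +
        ∑ k ∈ Finset.Icc n N, (1 / 2 : ℝ) * X 3 (k : ℤ) t ^ 2 := by
    rw [← Finset.sum_add_distrib]
    refine Finset.sum_congr rfl fun k _ => ?_
    rw [sum_sq_twinEmbed]; ring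
  have h3 := sideBranch_sum_mode3_le hε hν hinit hder n N (2 * θ) t ht
  have hpow : 0 ≤ (1 + ε₀) ^ (-(2 * θ * (n : ℝ))) := Real.rpow_nonneg (by linarith) _
  have hE0nn : 0 ≤ ∑ i : Fin 4, (1 / 2 : ℝ) * X₀ i ^ 2 :=
    Finset.sum_nonneg fun i _ => by positivity
  have h3' : (1 / 2 : ℝ) * X₀ 3 ^ 2 ≤ ∑ i : Fin 4, (1 / 2 : ℝ) * X₀ i ^ 2 := by
    rw [Fin.sum_univ_four]; nlinarith [sq_nonneg (X₀ 0), sq_nonneg (X₀ 1), sq_nonneg (X₀ 2)]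
  have hkey' : ∑ k ∈ Finset.Icc n N, ∑ i : Fin 4, (1 / 2 : ℝ) * twinEmbed X i (k : ℤ) t ^ 2 ≤
      C * (∑ i : Fin 4, (1 / 2 : ℝ) * X₀ i ^ 2) * (1 + ε₀) ^ (-(2 * θ * (n : ℝ))) :=
    key.trans (by
      have := mul_le_mul_of_nonneg_left hE0 hC
      nlinarith [mul_le_mul_of_nonneg_right this hpow])
  have hexp : (1 + ε₀) ^ (-(2 * θ * (n : ℝ))) = (1 + ε₀) ^ (-((2 * θ) * (n : ℝ))) := by ring_nf
  rw [hsplit]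
  have h3'' : ∑ k ∈ Finset.Icc n N, (1 / 2 : ℝ) * X 3 (k : ℤ) t ^ 2 ≤
      (∑ i : Fin 4, (1 / 2 : ℝ) * X₀ i ^ 2) * (1 + ε₀) ^ (-(2 * θ * (n : ℝ))) :=
    h3.trans (mul_le_mul_of_nonneg_right h3' hpow)
  nlinarith [hkey', h3'']

end Summit.NavierStokesRegularity.NavierStokesRegularity.Theorems

end
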